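import Literature.Computability.AlgebraicComplexity.KoiranPortierTavenas2015.SumOfProductsOfSparsePowers
import Mathlib.RingTheory.Polynomial.Vieta
import Mathlib.Algebra.Polynomial.Expand
import Mathlib.Combinatorics.Enumerative.DoubleCounting
import HarnessLib

/-!
# Koiran–Portier–Tavenas 2015, §6 "Optimality of Theorem 8": Lemmas 22–24 (the Wronskian of
# powers of one function) and Theorem 25 (PROVED)

P. Koiran, N. Portier, S. Tavenas, *A Wronskian approach to the real τ-conjecture*, J. Symbolic
Comput. **68**:2 (2015) 195–214 = arXiv:1205.1015 [KoiranPortierTavenas2015]; held text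
`paper:arxiv-1205.1015` (corpus-tex chunks `p0012`–`p0013` for §6; the numbering "Lemma 22, 23,
24, Theorem 25" is the one of that text and of the sibling files). THEOREMS ONLY (0 definitions,
0 named facts); fourth file of the directory after `WronskianZeroBounds.lean` (§2),
`WronskianZeroBoundsRefined.lean` (§5) and `SumOfProductsOfSparsePowers.lean` /
`SumOfProductsOfRealPowers.lean` (§3, §4.1), whose `wronskian` / `realZeros` vocabulary
(`Witness.lean`) and polynomial bridge `wronskian_eval_poly` it reuses. Printed statements:

* **Lemma 22** (p0012:L10–18): "Let `f` be a non-constant polynomial. There exists, for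
  `0 ≤ i ≤ q`, rational functions `F_{i,q}` such that if we define `h_{p,i} = p!/(p−i)! (f')^i
  f^{p−i}`, then: `F_{q,q} = 1`; `(f')^q F_{i,q}` is a polynomial; for all `q ≥ 0`, `p ≥ 1`,
  `(f^p)^{(q)} = Σ_{i=0}^{q} h_{p,i} F_{i,q}`. The main point is that `F_{i,q}` does not depend on
  `p`." — typed in the (equivalent, denominator-free) TRIANGULAR FORM for an arbitrary outer
  polynomial `g` in place of `y^p`: `exists_iterate_derivative_comp` ("`(g∘f)^{(v)} =
  Σ_{l≤v} B_{v,l} (g^{(l)}∘f)` with `B_{v,l}` independent of `g`, `B_{v,v} = (f')^v`") and its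
  determinant consequence `wronskian_det_comp` (`W(g_1∘f, …, g_s∘f) = (f')^{C(s,2)} ·
  W(g_1, …, g_s)∘f`, the matrix identity "`Δ = [h_{α_i+k,l−1}] [F_{l−1,j−1} 𝟙_{l≤j}]`" of
  p0012:L84–90); with `wronskian_det_X_pow` / `det_descFactorial_eq_prod_sub` (the monomial
  Wronskian and the falling-factorial Vandermonde "`det((α_i+k)!/(α_i+k−j+1)!)`", p0012:L95–100)
  this gives the closed form `wronskian_det_const_mul_pow`:
  `W(a_1 f^{e_1}, …, a_s f^{e_s}) = C(Π a_u · Π_{u<u'} (e_{u'} − e_u)) · (f')^{C(s,2)} ·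
  f^{Σ_u e_u − C(s,2)}`.
* **Lemma 23** (p0012:L65–69): "Let `f` be an analytic non-constant function in an interval `I`
  and `α_0, …, α_k` be `k` pairwise distinct integers (with `k ≥ 1`). Then
  `{x ∈ I | ∃ s ≤ k, W(f^{α_1+k}, …, f^{α_s+k})(x) = 0} ⊆ {x ∈ I | (ff')(x) = 0}`." —
  `KPT2015_lemma_23`.
* **Lemma 24** (p0013:L27–31): the same with "`k ≥ 2`" and EQUALITY — `KPT2015_lemma_24`.
* **Theorem 25** (p0013:L35–38): "Let `Υ = {x ∈ I | ∃ i ≤ k, W(f_1, …, f_i)(x) = 0}` as in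
  Theorem 8. For every `k` and `p`, there exists a function `g = Σ_{i=1}^k a_i f^{α_i}` such that
  `α_i` are positive integers, `f` is a polynomial such that `|Υ| ≥ p` and such that `g` has at
  least `(1 + |Υ|)(k − 1) + Z(f)` zeros." — `KPT2015_thm_25` (finite zero sets as `Finset`s) and
  `KPT2015_thm_25_realZeros` (the same in the `ℕ∞` / `realZeros` vocabulary of `KPT2015_thm_8_real`).
  (Theorem 8 itself, `Z ≤ (1+|Υ|)k − 1`, is `KPT2015_thm_8`; the §6 "Open question" following
  Theorem 25 is REFUTED in `AnswerNo.lean`.)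

**Typed-vs-printed (honest scope).** (1) `f` is a real POLYNOMIAL on `I = ℝ` throughout (Lemma 22
and Theorem 25 are printed for polynomials; Lemmas 23/24 are printed for an analytic non-constant
`f` on an interval — `-- TODO(general form)` on both); for a polynomial the hypothesis
"non-constant" of Lemma 23 is unnecessary (a constant `f` has `f' = 0`). (2) The exponents: the
print writes `α_i + k` with `α_0, …, α_k` "pairwise distinct integers"; we type pairwise distinct
NATURAL exponents `e_u` (`u < k`), non-zero constants `a_u` allowed in front (the Wronskian is
multilinear), and for Lemma 24 additionally `1 ≤ e_u` — the powers `p ≥ 1` of Lemma 22 and the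
"positive integers" of Theorem 25; for the exponents `{0, 1}` the printed equality is false
(`W(1, f) = f'` does not vanish at the simple zeros of `f`), so positivity cannot be dropped.
(3) Theorem 25: `Υ` is the set of `KPT2015_thm_8` for the family `f_i = f^{α_i}` on `Δ = ℝ`; the
finite sets `Υ`, `Z(g)`, `Z(f)` are delivered as `Finset`s with their defining equations, so that
the printed inequalities read `p ≤ |Υ|` and `(1 + |Υ|)(k − 1) + |Z(f)| ≤ |Z(g)|` in `ℕ`; we also
record `a_i ≠ 0` for `i < k` (the print's "`h` is `k`-sparse") and `α_i = 2i + 1 > 0`. The witness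
is the printed one with `p + 1` roots of `f` instead of `1 + ⌈(p+1)/2⌉` (see the section
docstring); the count of `|Υ|` uses Lemma 23 and degrees (`≤ 2q − 1`) and `W_1 = f` (`≥ q ≥ p`)
instead of the printed equality via Rolle and Lemma 24. (4) Everything in `Matrix.det` /
`Polynomial.derivative` language over a commutative ring where possible (`wronskian_det_comp`,
`wronskian_det_X_pow` for any nontrivial commutative ring without zero divisors), bridged to the
function-level `wronskian` of `Witness.lean` by `wronskian_eval_poly` (§3 file).

Census-neutral (no `def … : Prop`); not a rung of any ladder; VP ≠ VNP is of course NOT touched —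
this is the dictionary entry "KPT15 §6" next to Theorems 7–9, 12–13.
-/

noncomputable section

open Polynomial Finset

namespace Literature.Computability.AlgebraicComplexity.KoiranPortierTavenas2015

/-! ### The Wronskian of a composition: `W(g_1∘f, …, g_s∘f) = (f')^{C(s,2)} · W(g_1,…,g_s)∘f`

The chain rule iterated (Faà di Bruno) writes `(g∘f)^{(v)} = Σ_{l≤v} B_{v,l} · (g^{(l)}∘f)` with
polynomials `B_{v,l}` in `f', f'', …` NOT depending on `g`, `B_{v,v} = (f')^v`: the Wronskian matrix
of the `g_u∘f` is a lower-triangular matrix times the Wronskian matrix of the `g_u` composed with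
`f`. This is the structure behind the print's Lemma 22 (p0012:L10–18, "`(f^p)^{(q)} =
Σ_{i=0}^{q} h_{p,i} F_{i,q}` … the main point is that `F_{i,q}` does not depend on `p`"), written for
an arbitrary outer polynomial `g` instead of the power `y^p` (which avoids the print's rational
functions `F_{i,q}`). -/

section Composition

variable {R : Type*} [CommRing R]

/-- Faà di Bruno, triangular form: for each order `v` there are polynomials `B_0, …, B_v` in the
derivatives of `f` — independent of `g` — with `B_v = (f')^v`, `B_l = 0` for `l > v`, and
`(g∘f)^{(v)} = Σ_{l≤v} B_l · (g^{(l)}∘f)` for every `g`. [cite: KoiranPortierTavenas2015, Lemma 22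
(p0012:L10–18, structure of the derivatives of a composite)] -/
theorem exists_iterate_derivative_comp (f : R[X]) (v : ℕ) :
    ∃ B : ℕ → R[X], B v = derivative f ^ v ∧ (∀ l, v < l → B l = 0) ∧
      ∀ g : R[X], derivative^[v] (g.comp f) =
        ∑ l ∈ Finset.range (v + 1), B l * (derivative^[l] g).comp f := by
  induction v with
  | zero =>
    refine ⟨fun l => if l = 0 then 1 else 0, by simp, fun l hl => by simp [Nat.ne_of_gt hl], ?_⟩
    intro g
    simp
  | succ v ih =>
    obtain ⟨B, hBv, hB0, hB⟩ := ih
    refine ⟨fun l => derivative f * (if l = 0 then 0 else B (l - 1)) + derivative (B l), ?_, ?_, ?_⟩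
    · -- `B'_{v+1} = f' · B_v + (B_{v+1})' = (f')^{v+1}`
      simp only [Nat.add_eq_zero_iff, one_ne_zero, and_false, if_false, Nat.add_sub_cancel, hBv,
        hB0 (v + 1) (Nat.lt_succ_self v), derivative_zero, add_zero, pow_succ]
      ring
    · intro l hl
      have h1 : B (l - 1) = 0 := hB0 (l - 1) (by omega)
      have h2 : B l = 0 := hB0 l (by omega)
      simp [h1, h2]
    · intro g
      rw [Function.iterate_succ_apply', hB g, derivative_sum]
      -- differentiate term by term
      have hterm : ∀ l, derivative (B l * (derivative^[l] g).comp f) =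
          derivative (B l) * (derivative^[l] g).comp f +
            derivative f * B l * (derivative^[l + 1] g).comp f := by
        intro l
        rw [derivative_mul, derivative_comp, Function.iterate_succ_apply']
        ring
      simp only [hterm, Finset.sum_add_distrib]
      -- the right-hand side, reindexed
      have hR : ∑ l ∈ Finset.range (v + 1 + 1),
          (derivative f * (if l = 0 then 0 else B (l - 1)) + derivative (B l)) *
            (derivative^[l] g).comp f =
          ∑ l ∈ Finset.range (v + 1), derivative (B l) * (derivative^[l] g).comp f +
          ∑ l ∈ Finset.range (v + 1), derivative f * B l * (derivative^[l + 1] g).comp f := by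
        rw [Finset.sum_range_succ']
        simp only [Nat.add_eq_zero_iff, one_ne_zero, and_false, if_false, if_true,
          Nat.add_sub_cancel, mul_zero, zero_add, add_mul, Finset.sum_add_distrib]
        have h2 : ∑ l ∈ Finset.range (v + 1), derivative (B (l + 1)) *
            (derivative^[l + 1] g).comp f + derivative (B 0) * (derivative^[0] g).comp f =
            ∑ l ∈ Finset.range (v + 1), derivative (B l) * (derivative^[l] g).comp f := by
          rw [← Finset.sum_range_succ' (fun l => derivative (B l) * (derivative^[l] g).comp f),
            Finset.sum_range_succ, hB0 (v + 1) (Nat.lt_succ_self v), derivative_zero, zero_mul,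
            add_zero]
        rw [← h2]
        ring
      rw [hR]

/-- **The Wronskian of a composition**: for polynomials `g_0, …, g_{s−1}` and `f`,
`det((g_u∘f)^{(v)})_{v,u<s} = (f')^{C(s,2)} · (det((g_u)^{(l)})_{l,u<s}) ∘ f` (Pólya–Szegő style
change of variable in a Wronskian; the determinant form of the print's Lemma 22 factorisation
`Δ = [h_{α_i+k,l−1}] · [F_{l−1,j−1} 𝟙_{l≤j}]`, p0012:L84–90). [cite: KoiranPortierTavenas2015,
Lemma 23 (proof, p0012:L83–92)] -/
theorem wronskian_det_comp {s : ℕ} (g : Fin s → R[X]) (f : R[X]) :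
    Matrix.det (Matrix.of fun v u : Fin s => derivative^[(v : ℕ)] ((g u).comp f)) =
      derivative f ^ s.choose 2 *
        (Matrix.det (Matrix.of fun v u : Fin s => derivative^[(v : ℕ)] (g u))).comp f := by
  classical
  -- choose the triangular coefficients for each row
  have hrow := fun v : Fin s => exists_iterate_derivative_comp f (v : ℕ)
  choose B hBdiag hBzero hBexp using hrow
  -- matrix factorisation `M = L * (N ∘ f)`
  set L : Matrix (Fin s) (Fin s) R[X] := Matrix.of fun v l => B v l with hL
  set N : Matrix (Fin s) (Fin s) R[X] :=
    Matrix.of fun l u => (derivative^[(l : ℕ)] (g u)).comp f with hN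
  have hM : (Matrix.of fun v u : Fin s => derivative^[(v : ℕ)] ((g u).comp f)) = L * N := by
    refine Matrix.ext fun v u => ?_
    rw [Matrix.mul_apply, Matrix.of_apply, hBexp v (g u)]
    simp only [hL, hN, Matrix.of_apply]
    -- Σ_{l < v+1} = Σ_{l : Fin s} (terms with l > v vanish; terms with v < l < s … ; l ≥ s absent)
    rw [← Fin.sum_univ_eq_sum_range (fun l => B v l * (derivative^[l] (g u)).comp f) (v + 1)]
    -- both sides are sums over initial segments; compare via a common bound
    have key : ∀ n, (v : ℕ) + 1 ≤ n →
        ∑ l : Fin n, B v l * (derivative^[(l : ℕ)] (g u)).comp f =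
          ∑ l : Fin ((v : ℕ) + 1), B v l * (derivative^[(l : ℕ)] (g u)).comp f := by
      intro n hn
      obtain ⟨d, rfl⟩ := Nat.exists_eq_add_of_le hn
      induction d with
      | zero => rfl
      | succ d ihd =>
        rw [show (v : ℕ) + 1 + (d + 1) = ((v : ℕ) + 1 + d) + 1 from by ring, Fin.sum_univ_castSucc]
        simp only [Fin.val_castSucc, Fin.val_last]
        rw [hBzero v ((v : ℕ) + 1 + d) (by omega), zero_mul, add_zero]
        exact ihd (by omega)
    exact (key s (by omega)).symm
  have hLdet : L.det = derivative f ^ s.choose 2 := by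
    rw [Matrix.det_of_lowerTriangular L (fun i j hij => by
      simp only [hL, Matrix.of_apply]
      exact hBzero i j (by simpa using hij))]
    simp only [hL, Matrix.of_apply, hBdiag, Finset.prod_pow_eq_pow_sum]
    congr 1
    rw [Fin.sum_univ_eq_sum_range (fun i => i) s, Finset.sum_range_id, Nat.choose_two_right]
  have hNdet : N.det =
      (Matrix.det (Matrix.of fun v u : Fin s => derivative^[(v : ℕ)] (g u))).comp f := by
    change N.det = Polynomial.compRingHom f (Matrix.det _)
    rw [RingHom.map_det]
    rfl
  rw [hM, Matrix.det_mul, hLdet, hNdet]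

end Composition

/-! ### The Wronskian of monomials: `W(X^{e_0}, …, X^{e_{s−1}}) =
Π_{u<u'} (e_{u'} − e_u) · X^{Σe − C(s,2)}` -/

section Monomials

variable {R : Type*} [CommRing R]

/-- The falling-factorial Vandermonde determinant: `det((e_u)(e_u−1)⋯(e_u−v+1))_{v,u<s} =
Π_{u<u'} (e_{u'} − e_u)` (the print's "`det((α_i+k)!/(α_i+k−j+1)!)`", p0012:L99).
[cite: KoiranPortierTavenas2015, Lemma 23 (proof, p0012:L95–100)] -/
theorem det_descFactorial_eq_prod_sub [Nontrivial R] [NoZeroDivisors R] {s : ℕ} (e : Fin s → ℕ) :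
    Matrix.det (Matrix.of fun v u : Fin s => ((e u).descFactorial (v : ℕ) : R)) =
      ∏ u : Fin s, ∏ u' ∈ Finset.Ioi u, ((e u' : R) - e u) := by
  rw [← Matrix.det_transpose, ← Matrix.det_vandermonde]
  rw [Matrix.det_eval_matrixOfPolynomials_eq_det_vandermonde (fun u => (e u : R))
    (fun v => descPochhammer R v) (fun v => descPochhammer_natDegree R v)
    (fun v => monic_descPochhammer R v)]
  congr 1
  ext u v
  simp [Matrix.transpose_apply, descPochhammer_eval_eq_descFactorial]

/-- **The Wronskian of monomials**: `det((X^{e_u})^{(v)})_{v,u<s} =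
C(Π_{u<u'} (e_{u'} − e_u)) · X^{Σ_u e_u − C(s,2)}` (and `Σ_u e_u ≥ C(s,2)` whenever the
coefficient is non-zero). For a single function this is the print's
"`det(h_{α_i+k,j−1}) = [f^{Σα_l}] [(f')^{C(s,2)} f^{(k−s+1)s+C(s,2)}] det((α_i+k)!/(α_i+k−j+1)!)`"
with `f = X`. [cite: KoiranPortierTavenas2015, Lemma 23 (proof, p0012:L95–100)] -/
theorem wronskian_det_X_pow [Nontrivial R] [NoZeroDivisors R] {s : ℕ} (e : Fin s → ℕ) :
    Matrix.det (Matrix.of fun v u : Fin s => derivative^[(v : ℕ)] ((X : R[X]) ^ e u)) =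
      C (∏ u : Fin s, ∏ u' ∈ Finset.Ioi u, ((e u' : R) - e u)) *
        X ^ (∑ u, e u - s.choose 2) := by
  classical
  rw [← det_descFactorial_eq_prod_sub, Matrix.det_apply, Matrix.det_apply, map_sum,
    Finset.sum_mul]
  refine Finset.sum_congr rfl fun σ _ => ?_
  simp only [Matrix.of_apply, iterate_derivative_X_pow_eq_C_mul]
  have hsumσ : ∑ u : Fin s, ((σ u : Fin s) : ℕ) = s.choose 2 := by
    rw [Equiv.sum_comp σ (fun i : Fin s => (i : ℕ)), Fin.sum_univ_eq_sum_range (fun i => i) s,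
      Finset.sum_range_id, Nat.choose_two_right]
  by_cases hle : ∀ u, ((σ u : Fin s) : ℕ) ≤ e u
  · -- all exponents honest: collect the powers of `X`
    have hexp : ∑ u, (e u - ((σ u : Fin s) : ℕ)) = ∑ u, e u - s.choose 2 := by
      rw [← hsumσ]
      have h1 : ∑ u, (e u - ((σ u : Fin s) : ℕ)) + ∑ u, ((σ u : Fin s) : ℕ) = ∑ u, e u := by
        rw [← Finset.sum_add_distrib]
        exact Finset.sum_congr rfl fun u _ => Nat.sub_add_cancel (hle u)
      omega
    rw [Finset.prod_mul_distrib, Finset.prod_pow_eq_pow_sum, hexp, ← map_prod C,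
      Units.smul_def, Units.smul_def, zsmul_eq_mul, zsmul_eq_mul, Int.cast_comm]
    rw [map_mul, map_intCast]
    ring
  · -- some `σ u > e u`: the falling factorial vanishes on both sides
    push Not at hle
    obtain ⟨u, hu⟩ := hle
    have h0 : ((e u).descFactorial ((σ u : Fin s) : ℕ) : R) = 0 := by
      rw [Nat.descFactorial_eq_zero_iff_lt.mpr hu, Nat.cast_zero]
    rw [Finset.prod_eq_zero (Finset.mem_univ u) (by rw [h0, map_zero, zero_mul]),
      Finset.prod_eq_zero (Finset.mem_univ u) h0]
    simp

end Monomials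

/-! ### Lemmas 23 and 24: the Wronskian of powers of one polynomial -/

section Powers

/-- `W_1(F_0) = F_0` (a `1 × 1` determinant). [folklore] -/
private theorem wronskian_one_eq (f : ℕ → ℝ → ℝ) (x : ℝ) : wronskian f 1 x = f 0 x := by
  simp [wronskian]

/-- **The Wronskian of powers of one function** (the computation inside the proof of Lemma 23,
p0012:L83–100, in closed form): for a polynomial `f`, constants `a_u` and natural exponents `e_u`,
`det((a_u f^{e_u})^{(v)})_{v,u<s} = C(Π_u a_u · Π_{u<u'}(e_{u'} − e_u)) · (f')^{C(s,2)} ·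
f^{Σ_u e_u − C(s,2)}`. [cite: KoiranPortierTavenas2015, Lemma 23 (proof, p0012:L83–100)] -/
theorem wronskian_det_const_mul_pow {s : ℕ} (f : ℝ[X]) (a : Fin s → ℝ) (e : Fin s → ℕ) :
    Matrix.det (Matrix.of fun v u : Fin s => derivative^[(v : ℕ)] (C (a u) * f ^ e u)) =
      C ((∏ u, a u) * ∏ u : Fin s, ∏ u' ∈ Finset.Ioi u, ((e u' : ℝ) - e u)) *
        derivative f ^ s.choose 2 * f ^ (∑ u, e u - s.choose 2) := by
  classical
  have h1 : (Matrix.of fun v u : Fin s => derivative^[(v : ℕ)] (C (a u) * f ^ e u)) =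
      Matrix.of fun v u : Fin s => C (a u) *
        (Matrix.of fun v u : Fin s => derivative^[(v : ℕ)] (((X : ℝ[X]) ^ e u).comp f)) v u := by
    ext v u
    simp only [Matrix.of_apply, X_pow_comp, iterate_derivative_C_mul]
  rw [h1, Matrix.det_mul_row, wronskian_det_comp, wronskian_det_X_pow]
  simp only [mul_comp, C_comp, X_pow_comp, map_mul]
  rw [map_prod C a]
  ring

/-- **KPT 2015, Lemma 23** (p0012:L65–69): "Let `f` be an analytic non-constant function in an
interval `I` and `α_0, …, α_k` be `k` pairwise distinct integers (with `k ≥ 1`). Then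
`{x ∈ I | ∃ s ≤ k, W(f^{α_1+k}, …, f^{α_s+k})(x) = 0} ⊆ {x ∈ I | (ff')(x) = 0}`." TYPED ⊂
PRINTED (a restriction): a real POLYNOMIAL `f` on `I = ℝ` and pairwise distinct NATURAL exponents
`e_0, …, e_{k−1}` (the printed `α_i + k`), non-zero constants allowed in front (`a_u f^{e_u}`, the
Wronskian being multilinear), the prefix Wronskians being the sibling files' `wronskian F s`,
`F u = (x ↦ a_u f(x)^{e_u})`, `1 ≤ s ≤ k`. (For polynomials the hypothesis "non-constant" is not
needed: a constant `f` has `f' = 0`.) Proof as printed (p0012:L83–100) through the closed form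
`wronskian_det_const_mul_pow`.
-- TODO(general form): analytic non-constant `f` on an interval, integer (negative) exponents.
[cite: KoiranPortierTavenas2015, Lemma 23] -/
theorem KPT2015_lemma_23 (k : ℕ) (f : ℝ[X]) (a : ℕ → ℝ) (ha : ∀ u < k, a u ≠ 0) (e : ℕ → ℕ)
    (he : ∀ u < k, ∀ u' < k, u ≠ u' → e u ≠ e u') :
    {x : ℝ | ∃ s ∈ Finset.Icc 1 k,
        wronskian (fun u y => a u * (f.eval y) ^ e u) s x = 0} ⊆
      {x : ℝ | f.eval x * (derivative f).eval x = 0} := by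
  classical
  rintro x ⟨s, hs, hW⟩
  simp only [Finset.mem_Icc] at hs
  simp only [Set.mem_setOf_eq]
  have hpoly : wronskian (fun u y => a u * (f.eval y) ^ e u) s x =
      (Matrix.det (Matrix.of fun v u : Fin s =>
        derivative^[(v : ℕ)] (C (a u) * f ^ e (u : ℕ)))).eval x := by
    have := wronskian_eval_poly (fun u => C (a u) * f ^ e u) s x
    simpa [eval_mul, eval_pow, eval_C] using this
  rw [hpoly, wronskian_det_const_mul_pow, eval_mul, eval_mul, eval_C, eval_pow, eval_pow] at hW
  have hconst : (∏ u : Fin s, a u) * ∏ u : Fin s, ∏ u' ∈ Finset.Ioi u, ((e u' : ℝ) - e u) ≠ 0 := by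
    refine mul_ne_zero (Finset.prod_ne_zero_iff.mpr fun u _ => ha u (by omega))
      (Finset.prod_ne_zero_iff.mpr fun u _ => Finset.prod_ne_zero_iff.mpr fun u' hu' => ?_)
    have hlt : u < u' := Finset.mem_Ioi.mp hu'
    have hne : e u' ≠ e u := he u' (by omega) u (by omega) (fun h => by
      have : (u' : ℕ) = u := h
      exact absurd (Fin.ext this) (ne_of_gt hlt))
    exact sub_ne_zero.mpr (by exact_mod_cast hne)
  rcases mul_eq_zero.mp hW with h12 | h3
  · rcases mul_eq_zero.mp h12 with h1 | h2
    · exact absurd h1 hconst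
    · have := (pow_eq_zero_iff'.mp h2).1
      rw [this, mul_zero]
  · have := (pow_eq_zero_iff'.mp h3).1
    rw [this, zero_mul]

/-- **KPT 2015, Lemma 24** (p0013:L27–31): "Let `f` be an analytic non-constant function in an
interval `I` and `α_0, …, α_k` be `k` pairwise distinct integers with the condition `k ≥ 2`. Then
`{x ∈ I | ∃ s ≤ k, W(f^{α_1+k}, …, f^{α_s+k})(x) = 0} = {x ∈ I | (ff')(x) = 0}`." TYPED ⊂
PRINTED (a restriction), as `KPT2015_lemma_23` (real polynomial `f` on `ℝ`, pairwise distinct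
natural exponents, non-zero constants), `k ≥ 2`, and with the exponents POSITIVE (`1 ≤ e_u`: the
powers `p ≥ 1` of Lemma 22 and the "positive integers `α_i`" of Theorem 25, the lemma's only
printed use). The positivity cannot be dropped: for the exponent set `{0, 1}` (allowed by the
printed wording "pairwise distinct integers") `W(1, f) = f'`, so the left-hand side is `Z(f')`,
not `Z(ff')`, whenever `f` has a simple zero — recorded as
`KPT2015_lemma_24_fails_for_exponents_zero_one` below. The inclusion `⊇` comes from
`W_2 = a_0 a_1 (e_1 − e_0) f^{e_0+e_1−1} f'` with `e_0 + e_1 − 1 ≥ 1`.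
-- TODO(general form): analytic non-constant `f` on an interval.
[cite: KoiranPortierTavenas2015, Lemma 24] -/
theorem KPT2015_lemma_24 (k : ℕ) (hk : 2 ≤ k) (f : ℝ[X]) (a : ℕ → ℝ) (ha : ∀ u < k, a u ≠ 0)
    (e : ℕ → ℕ) (he : ∀ u < k, ∀ u' < k, u ≠ u' → e u ≠ e u') (hpos : ∀ u < k, 1 ≤ e u) :
    {x : ℝ | ∃ s ∈ Finset.Icc 1 k,
        wronskian (fun u y => a u * (f.eval y) ^ e u) s x = 0} =
      {x : ℝ | f.eval x * (derivative f).eval x = 0} := by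
  classical
  refine Set.Subset.antisymm (KPT2015_lemma_23 k f a ha e he) ?_
  intro x hx
  simp only [Set.mem_setOf_eq] at hx ⊢
  refine ⟨2, Finset.mem_Icc.mpr ⟨by norm_num, hk⟩, ?_⟩
  have hpoly : wronskian (fun u y => a u * (f.eval y) ^ e u) 2 x =
      (Matrix.det (Matrix.of fun v u : Fin 2 =>
        derivative^[(v : ℕ)] (C (a u) * f ^ e (u : ℕ)))).eval x := by
    have := wronskian_eval_poly (fun u => C (a u) * f ^ e u) 2 x
    simpa [eval_mul, eval_pow, eval_C] using this
  rw [hpoly, wronskian_det_const_mul_pow, eval_mul, eval_mul, eval_pow, eval_pow]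
  -- `C(2,2) = 1` and `e_0 + e_1 − 1 ≥ 1`
  have h0 : 1 ≤ e 0 := hpos 0 (by omega)
  have h1 : 1 ≤ e 1 := hpos 1 (by omega)
  have hsum : 1 ≤ ∑ u : Fin 2, e (u : ℕ) - Nat.choose 2 2 := by
    rw [Fin.sum_univ_two, Nat.choose_self]
    show 1 ≤ e 0 + e 1 - 1
    omega
  obtain ⟨r, hr⟩ := Nat.exists_eq_add_of_le hsum
  rw [hr, Nat.choose_self, pow_one, pow_add, pow_one]
  rcases mul_eq_zero.mp hx with h0 | h0 <;> simp [h0]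

/-- The printed wording of Lemma 24 fails at the edge: exponents `{0, 1}` (allowed by "pairwise
distinct integers `α_i`" with `α_i + k ∈ {0, 1}`), `f = x` on `ℝ`, `k = 2`, constants `1`: the
prefix Wronskians are `W_1 = 1` and `W_2 = W(1, x) = 1`, so the left-hand side is empty while
`Z(ff') = {0}` — whence the hypothesis `1 ≤ e_u` of `KPT2015_lemma_24` (a disclosed deviation from
the printed wording, not a claim of the source). [cite: KoiranPortierTavenas2015, Lemma 24
(p0013:L27–31, edge case of the printed wording)] -/
theorem KPT2015_lemma_24_fails_for_exponents_zero_one :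
    {x : ℝ | ∃ s ∈ Finset.Icc 1 2, wronskian (fun u y => (1 : ℝ) * ((X : ℝ[X]).eval y) ^
        (if u = 0 then 0 else 1)) s x = 0} ≠
      {x : ℝ | (X : ℝ[X]).eval x * (derivative (X : ℝ[X])).eval x = 0} := by
  intro h
  have h0 : (0 : ℝ) ∈ {x : ℝ | (X : ℝ[X]).eval x * (derivative (X : ℝ[X])).eval x = 0} := by
    simp
  rw [← h] at h0
  obtain ⟨s, hs, hW⟩ := h0
  rw [Finset.mem_Icc] at hs
  simp only [eval_X] at hW
  rcases (show s = 1 ∨ s = 2 by omega) with rfl | rfl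
  · rw [wronskian_one_eq] at hW
    norm_num at hW
  · have h2 : wronskian (fun u y => (1 : ℝ) * y ^ (if u = 0 then 0 else 1)) 2 0 = 1 := by
      simp [wronskian, Matrix.det_fin_two]
    rw [h2] at hW
    exact one_ne_zero hW

end Powers

/-! ### Theorem 25: Theorem 8 is optimal up to the factor `k/(k−1)`

The witness of the print (p0013:L40–45): "`h = x Π_{i=1}^{k−1} (x² − i²)`. This polynomial is
`k`-sparse and has `2k−1` distinct real roots … `f = k Π_{i=1}^{1+⌈(p+1)/2⌉} (x − 2i)` … `g = h∘f`".
We type `h = X · (expand 2 Q)` with `Q = Π_{i<k−1} (X − C (i+1)²)`, so that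
`g(x) = Σ_{i<k} Q_i f(x)^{2i+1}` with `Q_i = Q.coeff i ≠ 0` (Vieta: the coefficients of
`Π (X − c_i)`, `c_i > 0`, have the strict sign `(−1)^{k−1−i}`), and `f = C k · Π_{i<q} (X − C 2(i+1))`
with the `q = p + 1` simple roots `2, 4, …, 2q` (the print takes `1 + ⌈(p+1)/2⌉` roots; any number
`≥ (p+1)/2` of them works, `p + 1` keeps the arithmetic in `ℕ`). -/

section Optimality

variable {k q : ℕ} {F Q : ℝ[X]}

/-- `|2n + 1 − 2(i+1)| ≥ 1` for naturals `n, i`. [folklore] -/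
private theorem one_le_abs_odd_sub_even (n i : ℕ) :
    (1 : ℝ) ≤ |2 * (n : ℝ) + 1 - 2 * ((i : ℝ) + 1)| := by
  rcases Nat.lt_or_ge i n with h | h
  · have h' : (i : ℝ) + 1 ≤ n := by exact_mod_cast h
    rw [abs_of_nonneg (by linarith)]
    linarith
  · have h' : (n : ℝ) ≤ i := by exact_mod_cast h
    rw [abs_of_nonpos (by linarith)]
    linarith

/-- `f(y) = k · Π_{i<q} (y − 2(i+1))`. [folklore] -/
private theorem witnessF_eval
    (hF : F = C (k : ℝ) * ∏ i ∈ Finset.range q, (X - C (2 * ((i : ℝ) + 1)))) (y : ℝ) :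
    F.eval y = k * ∏ i ∈ Finset.range q, (y - 2 * ((i : ℝ) + 1)) := by
  subst hF
  simp [eval_prod]

/-- `f` vanishes at the even integers `2m + 2`, `m < q`. [folklore] -/
private theorem witnessF_eval_even
    (hF : F = C (k : ℝ) * ∏ i ∈ Finset.range q, (X - C (2 * ((i : ℝ) + 1)))) {m : ℕ}
    (hm : m < q) : F.eval ((2 * m + 2 : ℕ) : ℝ) = 0 := by
  rw [witnessF_eval hF]
  refine mul_eq_zero_of_right _ (Finset.prod_eq_zero (Finset.mem_range.mpr hm) ?_)
  push_cast
  ring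

/-- `|f| ≥ k` at every odd integer `2n + 1` (p0013:L47: "for `y` an odd integer, `|f(y)| > k−1`").
[folklore] -/
private theorem witnessF_abs_eval_odd
    (hF : F = C (k : ℝ) * ∏ i ∈ Finset.range q, (X - C (2 * ((i : ℝ) + 1)))) (n : ℕ) :
    (k : ℝ) ≤ |F.eval ((2 * n + 1 : ℕ) : ℝ)| := by
  rw [witnessF_eval hF, abs_mul, Nat.abs_cast, Finset.abs_prod]
  refine le_mul_of_one_le_right (Nat.cast_nonneg k) ?_
  refine Finset.prod_induction _ (fun x : ℝ => 1 ≤ x)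
    (fun a b ha hb => one_le_mul_of_one_le_of_one_le ha hb) le_rfl ?_
  intro i _
  push_cast
  exact one_le_abs_odd_sub_even n i

/-- `f ≠ 0` (for `k ≥ 1`). [folklore] -/
private theorem witnessF_ne_zero
    (hF : F = C (k : ℝ) * ∏ i ∈ Finset.range q, (X - C (2 * ((i : ℝ) + 1)))) (hk : 1 ≤ k) :
    F ≠ 0 := by
  intro h0
  have h1 := witnessF_abs_eval_odd hF 0
  rw [h0, eval_zero, abs_zero] at h1
  have : (1 : ℝ) ≤ k := by exact_mod_cast hk
  linarith

/-- `f' ≠ 0` (for `k, q ≥ 1`: `f(2) = 0 ≠ f(1)`, so `f` is not constant). [folklore] -/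
private theorem witnessF_derivative_ne_zero
    (hF : F = C (k : ℝ) * ∏ i ∈ Finset.range q, (X - C (2 * ((i : ℝ) + 1)))) (hk : 1 ≤ k)
    (hq : 1 ≤ q) : derivative F ≠ 0 := by
  intro h0
  have hC := eq_C_of_natDegree_eq_zero (derivative_eq_zero.mp h0)
  have h1 := witnessF_abs_eval_odd hF 0
  have h2 := witnessF_eval_even hF (show 0 < q from hq)
  rw [hC, eval_C] at h1 h2
  rw [h2, abs_zero] at h1
  have : (1 : ℝ) ≤ k := by exact_mod_cast hk
  linarith

/-- `deg f ≤ q`. [folklore] -/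
private theorem witnessF_natDegree_le
    (hF : F = C (k : ℝ) * ∏ i ∈ Finset.range q, (X - C (2 * ((i : ℝ) + 1)))) :
    F.natDegree ≤ q := by
  subst hF
  refine (natDegree_C_mul_le _ _).trans ((natDegree_prod_le _ _).trans (le_of_eq ?_))
  simp only [natDegree_X_sub_C, Finset.sum_const, Finset.card_range, smul_eq_mul, mul_one]

/-- `h(y) = y · Π_{i<k−1} (y² − (i+1)²)`. [folklore] -/
private theorem witnessH_eval
    (hQ : Q = ∏ i ∈ Finset.range (k - 1), (X - C (((i : ℝ) + 1) ^ 2))) (y : ℝ) :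
    (X * expand ℝ 2 Q).eval y = y * ∏ i ∈ Finset.range (k - 1), (y ^ 2 - ((i : ℝ) + 1) ^ 2) := by
  subst hQ
  simp [eval_prod]

/-- `deg Q ≤ k − 1 < k`. [folklore] -/
private theorem witnessQ_natDegree_lt
    (hQ : Q = ∏ i ∈ Finset.range (k - 1), (X - C (((i : ℝ) + 1) ^ 2))) (hk : 1 ≤ k) :
    Q.natDegree < k := by
  subst hQ
  refine lt_of_le_of_lt (natDegree_prod_le _ _) ?_
  simp only [natDegree_X_sub_C, Finset.sum_const, Finset.card_range, smul_eq_mul, mul_one]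
  omega

/-- The `k`-sparse representation `h(y) = Σ_{i<k} Q_i · y^{2i+1}` (p0013:L40: "this polynomial is
`k`-sparse"). [folklore] -/
private theorem witnessH_eval_eq_sum
    (hQ : Q = ∏ i ∈ Finset.range (k - 1), (X - C (((i : ℝ) + 1) ^ 2))) (hk : 1 ≤ k) (y : ℝ) :
    (X * expand ℝ 2 Q).eval y = ∑ i ∈ Finset.range k, Q.coeff i * y ^ (2 * i + 1) := by
  rw [eval_mul, eval_X, expand_eval, eval_eq_sum_range' (witnessQ_natDegree_lt hQ hk),
    Finset.mul_sum]
  refine Finset.sum_congr rfl fun i _ => ?_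
  ring

/-- The coefficients of `Q = Π_{i<k−1} (X − C (i+1)²)` of index `< k` do not vanish (Vieta:
`Q_i = (−1)^{k−1−i} e_{k−1−i}((1², …, (k−1)²))` with a positive elementary symmetric function).
[folklore] -/
private theorem witnessQ_coeff_ne_zero
    (hQ : Q = ∏ i ∈ Finset.range (k - 1), (X - C (((i : ℝ) + 1) ^ 2))) {i : ℕ} (hi : i < k) :
    Q.coeff i ≠ 0 := by
  subst hQ
  have hs : i ≤ (Finset.range (k - 1)).card := by rw [Finset.card_range]; omega
  have hrw : ∏ i ∈ Finset.range (k - 1), (X - C (((i : ℝ) + 1) ^ 2)) =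
      ∏ i ∈ Finset.range (k - 1), (X + C (-(((i : ℝ) + 1) ^ 2))) := by
    refine Finset.prod_congr rfl fun i _ => ?_
    rw [map_neg, ← sub_eq_add_neg]
  rw [hrw, Finset.prod_X_add_C_coeff _ (fun i : ℕ => -(((i : ℝ) + 1) ^ 2)) hs]
  have hterm : ∀ t ∈ (Finset.range (k - 1)).powersetCard ((Finset.range (k - 1)).card - i),
      ∏ j ∈ t, (-(((j : ℝ) + 1) ^ 2)) =
        (-1) ^ ((Finset.range (k - 1)).card - i) * ∏ j ∈ t, ((j : ℝ) + 1) ^ 2 := by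
    intro t ht
    rw [Finset.prod_neg, (Finset.mem_powersetCard.mp ht).2]
  rw [Finset.sum_congr rfl hterm, ← Finset.mul_sum]
  refine mul_ne_zero (pow_ne_zero _ (by norm_num)) (ne_of_gt (Finset.sum_pos ?_ ?_))
  · intro t _
    exact Finset.prod_pos fun j _ => by positivity
  · exact Finset.powersetCard_nonempty.mpr (Nat.sub_le _ _)

/-- Intermediate values: if `f` vanishes at one end of `[a, b]` and `|f| > j > 0` at the other,
then `|f| = j` somewhere in `]a, b[` (p0013:L48: "By the Intermediate Value Theorem …").
[folklore] -/
private theorem exists_Ioo_abs_eval_eq (F : ℝ[X]) {a b : ℝ} (hab : a < b) {j : ℝ} (hj : 0 < j)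
    (h : (F.eval b = 0 ∧ j < |F.eval a|) ∨ (F.eval a = 0 ∧ j < |F.eval b|)) :
    ∃ x ∈ Set.Ioo a b, |F.eval x| = j := by
  have hc : ContinuousOn (fun x => F.eval x) (Set.Icc a b) := F.continuous.continuousOn
  rcases h with ⟨hb, ha⟩ | ⟨ha, hb⟩
  · by_cases hpos : 0 < F.eval a
    · rw [abs_of_pos hpos] at ha
      obtain ⟨x, hx, hfx⟩ := intermediate_value_Ioo' hab.le hc
        ⟨show F.eval b < j by rw [hb]; exact hj, show j < F.eval a from ha⟩
      exact ⟨x, hx, by rw [show F.eval x = j from hfx, abs_of_pos hj]⟩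
    · have hneg : F.eval a < 0 := by
        rcases lt_or_eq_of_le (not_lt.mp hpos) with h | h
        · exact h
        · rw [h, abs_zero] at ha
          linarith
      rw [abs_of_neg hneg] at ha
      obtain ⟨x, hx, hfx⟩ := intermediate_value_Ioo hab.le hc
        ⟨show F.eval a < -j by linarith, show -j < F.eval b by rw [hb]; linarith⟩
      exact ⟨x, hx, by rw [show F.eval x = -j from hfx, abs_of_neg (by linarith), neg_neg]⟩
  · by_cases hpos : 0 < F.eval b
    · rw [abs_of_pos hpos] at hb
      obtain ⟨x, hx, hfx⟩ := intermediate_value_Ioo hab.le hc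
        ⟨show F.eval a < j by rw [ha]; exact hj, show j < F.eval b from hb⟩
      exact ⟨x, hx, by rw [show F.eval x = j from hfx, abs_of_pos hj]⟩
    · have hneg : F.eval b < 0 := by
        rcases lt_or_eq_of_le (not_lt.mp hpos) with h | h
        · exact h
        · rw [h, abs_zero] at hb
          linarith
      rw [abs_of_neg hneg] at hb
      obtain ⟨x, hx, hfx⟩ := intermediate_value_Ioo' hab.le hc
        ⟨show F.eval b < -j by linarith, show -j < F.eval a by rw [ha]; linarith⟩
      exact ⟨x, hx, by rw [show F.eval x = -j from hfx, abs_of_neg (by linarith), neg_neg]⟩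

/-- `g = h∘f` vanishes where `|f| = j + 1`, `j < k − 1` (p0013:L46: "`g(x) = 0` iff
`f(x) ∈ [−k+1, k−1] ∩ ℤ`"). [folklore] -/
private theorem witnessG_eval_eq_zero_of_abs
    (hQ : Q = ∏ i ∈ Finset.range (k - 1), (X - C (((i : ℝ) + 1) ^ 2))) {y : ℝ} {j : ℕ}
    (hj : j < k - 1) (hy : |F.eval y| = (j : ℝ) + 1) : ((X * expand ℝ 2 Q).comp F).eval y = 0 := by
  rw [eval_comp, witnessH_eval hQ]
  refine mul_eq_zero_of_right _ (Finset.prod_eq_zero (Finset.mem_range.mpr hj) ?_)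
  rw [← sq_abs, hy, sub_self]

/-- `g = h∘f` vanishes where `f` does. [folklore] -/
private theorem witnessG_eval_eq_zero_of_eval
    (hQ : Q = ∏ i ∈ Finset.range (k - 1), (X - C (((i : ℝ) + 1) ^ 2))) {y : ℝ}
    (hy : F.eval y = 0) : ((X * expand ℝ 2 Q).comp F).eval y = 0 := by
  rw [eval_comp, witnessH_eval hQ, hy, zero_mul]

/-- `g = h∘f ≠ 0`: at `y = 1`, `|f(1)| ≥ k` exceeds every root of `h`. [folklore] -/
private theorem witnessG_ne_zero
    (hF : F = C (k : ℝ) * ∏ i ∈ Finset.range q, (X - C (2 * ((i : ℝ) + 1))))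
    (hQ : Q = ∏ i ∈ Finset.range (k - 1), (X - C (((i : ℝ) + 1) ^ 2))) (hk : 1 ≤ k) :
    (X * expand ℝ 2 Q).comp F ≠ 0 := by
  intro h0
  have h1 := witnessF_abs_eval_odd hF 0
  have hk' : (1 : ℝ) ≤ k := by exact_mod_cast hk
  have hne : ((X * expand ℝ 2 Q).comp F).eval ((2 * 0 + 1 : ℕ) : ℝ) ≠ 0 := by
    rw [eval_comp, witnessH_eval hQ]
    refine mul_ne_zero (fun h => by rw [h, abs_zero] at h1; linarith) ?_
    refine Finset.prod_ne_zero_iff.mpr fun i hi => ?_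
    have hik : i + 1 + 1 ≤ k := by have := Finset.mem_range.mp hi; omega
    have hik' : ((i + 1 + 1 : ℕ) : ℝ) ≤ k := by exact_mod_cast hik
    push_cast at hik'
    have h0 : (0 : ℝ) ≤ (i : ℝ) + 1 := by positivity
    have hlt : (i : ℝ) + 1 < |F.eval ((2 * 0 + 1 : ℕ) : ℝ)| := by linarith
    have hsq : ((i : ℝ) + 1) ^ 2 < |F.eval ((2 * 0 + 1 : ℕ) : ℝ)| ^ 2 := by nlinarith
    rw [← sq_abs (F.eval _)]
    exact (sub_pos.mpr hsq).ne'
  exact hne (by rw [h0, eval_zero])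

/-- **KPT 2015, Theorem 25** (p0013:L35–38, "Optimality of Theorem 8"): "Let
`Υ = {x ∈ I | ∃ i ≤ k, W(f_1, …, f_i)(x) = 0}` as in Theorem 8. For every `k` and `p`, there exists
a function `g = Σ_{i=1}^k a_i f^{α_i}` such that `α_i` are positive integers, `f` is a polynomial
such that `|Υ| ≥ p` and such that `g` has at least `(1 + |Υ|)(k − 1) + Z(f)` zeros." Typed on
`I = ℝ` with the sibling files' `wronskian` (the prefix Wronskians of the family `f_i = f^{α_i}`,
`1 ≤ i ≤ k`, exactly the `Υ` of `KPT2015_thm_8`), the three finite zero sets being produced as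
`Finset`s: `Υ`, the zero set `Zg` of `g = Σ_{i<k} a_i f^{α_i}` and the zero set `Zf` of `f`, with
`p ≤ |Υ|` and `(1 + |Υ|)(k − 1) + |Zf| ≤ |Zg|`; moreover (as in the printed proof, where `h` is
`k`-sparse) every coefficient `a_i`, `i < k`, is non-zero and every exponent is positive (`α_i =
2i + 1`). `k ≥ 1` (for `k = 0` there is no function). PROOF (p0013:L40–66) followed with the
witness described above: `|Zg| ≥ 2q(k−1) + q` by the intermediate value theorem on the `2q` unit
intervals next to the roots `2, …, 2q` of `f` (`|f| ≥ k` at odd integers), `|Zf| ≤ deg f = q`,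
`q ≤ |Υ|` because `W_1 = f`, and `|Υ| ≤ Z(f) + Z(f') ≤ 2q − 1` by Lemma 23 (`KPT2015_lemma_23`)
and degrees — the print obtains the equality `|Υ| = Z(ff') = 2q − 1` from Rolle's theorem and
Lemma 24, which the inequality does not need. A LOWER-BOUND CONSTRUCTION for Theorem 8
(`KPT2015_thm_8`: `Z ≤ (1 + |Υ|)k − 1`), consistent with — and not bearing on — the REFUTED §6
"Open question" `Z ≤ k − 1 + Σ_i Z(W_i)` of the sibling `AnswerNo.lean`
(`kpt_open_question_answer_is_no`, `tavenasWronskianBound_false`), which is neither restated nor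
weakened here. [cite: KoiranPortierTavenas2015, Theorem 25] -/
theorem KPT2015_thm_25 (k p : ℕ) (hk : 1 ≤ k) :
    ∃ (f : ℝ[X]) (a : ℕ → ℝ) (α : ℕ → ℕ) (Υ Zg Zf : Finset ℝ),
      (∀ i < k, 0 < α i) ∧ (∀ i < k, a i ≠ 0) ∧
      (↑Υ = {x : ℝ | ∃ i, 1 ≤ i ∧ i ≤ k ∧ wronskian (fun i y => f.eval y ^ α i) i x = 0}) ∧
      (↑Zg = {x : ℝ | ∑ i ∈ Finset.range k, a i * f.eval x ^ α i = 0}) ∧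
      (↑Zf = {x : ℝ | f.eval x = 0}) ∧
      p ≤ Υ.card ∧ (1 + Υ.card) * (k - 1) + Zf.card ≤ Zg.card := by
  classical
  obtain ⟨k', rfl⟩ : ∃ k', k = k' + 1 := ⟨k - 1, by omega⟩
  -- the witness: `q = p + 1` roots of `f`
  obtain ⟨q, hqp⟩ : ∃ q : ℕ, q = p + 1 := ⟨_, rfl⟩
  have hq1 : 1 ≤ q := by omega
  obtain ⟨F, hF⟩ : ∃ F : ℝ[X],
      F = C ((k' + 1 : ℕ) : ℝ) * ∏ i ∈ Finset.range q, (X - C (2 * ((i : ℝ) + 1))) := ⟨_, rfl⟩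
  obtain ⟨Q, hQ⟩ : ∃ Q : ℝ[X],
      Q = ∏ i ∈ Finset.range (k' + 1 - 1), (X - C (((i : ℝ) + 1) ^ 2)) := ⟨_, rfl⟩
  obtain ⟨G, hGdef⟩ : ∃ G : ℝ[X], G = (X * expand ℝ 2 Q).comp F := ⟨_, rfl⟩
  have hF0 : F ≠ 0 := witnessF_ne_zero hF (by omega)
  have hF'0 : derivative F ≠ 0 := witnessF_derivative_ne_zero hF (by omega) hq1
  have hG0 : G ≠ 0 := by rw [hGdef]; exact witnessG_ne_zero hF hQ (by omega)
  have hGeval : ∀ x, G.eval x = ∑ i ∈ Finset.range (k' + 1), Q.coeff i * F.eval x ^ (2 * i + 1) := by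
    intro x
    rw [hGdef, eval_comp, witnessH_eval_eq_sum hQ (by omega)]
  -- the three finite zero sets
  obtain ⟨Υ, hΥdef⟩ : ∃ Υ : Finset ℝ, Υ = (F.roots.toFinset ∪ (derivative F).roots.toFinset).filter
      (fun x => ∃ i, 1 ≤ i ∧ i ≤ k' + 1 ∧
        wronskian (fun i y => F.eval y ^ (2 * i + 1)) i x = 0) := ⟨_, rfl⟩
  obtain ⟨Zg, hZgdef⟩ : ∃ Zg : Finset ℝ, Zg = G.roots.toFinset := ⟨_, rfl⟩
  obtain ⟨Zf, hZfdef⟩ : ∃ Zf : Finset ℝ, Zf = F.roots.toFinset := ⟨_, rfl⟩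
  have hmemZg : ∀ x, x ∈ Zg ↔ G.eval x = 0 := fun x => by
    rw [hZgdef, Multiset.mem_toFinset, mem_roots hG0, IsRoot.def]
  have hmemZf : ∀ x, x ∈ Zf ↔ F.eval x = 0 := fun x => by
    rw [hZfdef, Multiset.mem_toFinset, mem_roots hF0, IsRoot.def]
  -- Lemma 23: the prefix-Wronskian zeros are zeros of `f f'`
  have hΥsub : ∀ x, (∃ i, 1 ≤ i ∧ i ≤ k' + 1 ∧
      wronskian (fun i y => F.eval y ^ (2 * i + 1)) i x = 0) →
      F.eval x * (derivative F).eval x = 0 := by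
    rintro x ⟨i, hi1, hik, hW⟩
    have he : ∀ u < k' + 1, ∀ u' < k' + 1, u ≠ u' → 2 * u + 1 ≠ 2 * u' + 1 := by
      intro u _ u' _ h
      omega
    have h23 := KPT2015_lemma_23 (k' + 1) F (fun _ => (1 : ℝ)) (fun _ _ => one_ne_zero)
      (fun u => 2 * u + 1) he
    simp only [one_mul] at h23
    exact h23 ⟨i, Finset.mem_Icc.mpr ⟨hi1, hik⟩, hW⟩
  have hmemΥ : ∀ x, x ∈ Υ ↔ ∃ i, 1 ≤ i ∧ i ≤ k' + 1 ∧
      wronskian (fun i y => F.eval y ^ (2 * i + 1)) i x = 0 := by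
    intro x
    rw [hΥdef, Finset.mem_filter]
    constructor
    · exact fun h => h.2
    · intro hx
      refine ⟨?_, hx⟩
      rw [Finset.mem_union, Multiset.mem_toFinset, Multiset.mem_toFinset, mem_roots hF0,
        mem_roots hF'0, IsRoot.def, IsRoot.def]
      exact mul_eq_zero.mp (hΥsub x hx)
  -- (1) `|Zf| ≤ q` and `|Υ| ≤ 2q − 1`
  have hrootsF : F.roots.toFinset.card ≤ q :=
    (Multiset.toFinset_card_le _).trans ((card_roots' F).trans (witnessF_natDegree_le hF))
  have hrootsF' : (derivative F).roots.toFinset.card ≤ q - 1 :=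
    (Multiset.toFinset_card_le _).trans ((card_roots' _).trans
      ((natDegree_derivative_le F).trans (Nat.sub_le_sub_right (witnessF_natDegree_le hF) 1)))
  have hZf_le : Zf.card ≤ q := by rw [hZfdef]; exact hrootsF
  have hΥ_le : 1 + Υ.card ≤ 2 * q := by
    have h1 : Υ.card ≤ (F.roots.toFinset ∪ (derivative F).roots.toFinset).card := by
      rw [hΥdef]
      exact Finset.card_filter_le _ _
    have h2 := Finset.card_union_le F.roots.toFinset (derivative F).roots.toFinset
    omega
  -- (2) `p ≤ q ≤ |Υ|`: `W_1 = f` vanishes at `2, 4, …, 2q`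
  have hW1 : ∀ x, wronskian (fun i y => F.eval y ^ (2 * i + 1)) 1 x = F.eval x := by
    intro x
    rw [wronskian_one_eq]
    norm_num
  have hp_le : p ≤ Υ.card := by
    have hsub : (Finset.range q).image (fun m : ℕ => ((2 * m + 2 : ℕ) : ℝ)) ⊆ Υ := by
      intro x hx
      obtain ⟨m, hm, rfl⟩ := Finset.mem_image.mp hx
      rw [hmemΥ]
      exact ⟨1, le_rfl, by omega, by
        rw [hW1]; exact witnessF_eval_even hF (Finset.mem_range.mp hm)⟩
    have hinj : Function.Injective (fun m : ℕ => ((2 * m + 2 : ℕ) : ℝ)) := by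
      intro a b h
      simp only at h
      have h' : 2 * a + 2 = 2 * b + 2 := by exact_mod_cast h
      omega
    have hcard := Finset.card_le_card hsub
    rw [Finset.card_image_of_injective _ hinj, Finset.card_range] at hcard
    omega
  -- (3) `|Zg| ≥ 2q(k−1) + q`: double counting of labelled zeros of `g`
  have hZg_ge : q * (2 * k' + 1) ≤ Zg.card := by
    have hcardL : (Finset.range q ×ˢ Finset.range (2 * k' + 1)).card = q * (2 * k' + 1) := by
      rw [Finset.card_product, Finset.card_range, Finset.card_range]
    rw [← hcardL]
    -- label `(m, n)`: for `n < 2k'` a zero in the unit interval `]2m+1+s, 2m+2+s[`, `s = n % 2`,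
    -- with `|f| = n/2 + 1` there; for `n = 2k'` the root `2m + 2` of `f` itself
    refine Finset.card_le_card_of_forall_subsingleton
      (fun (l : ℕ × ℕ) (x : ℝ) =>
        (l.2 < 2 * k' ∧ x ∈ Set.Ioo ((2 * l.1 + 1 + l.2 % 2 : ℕ) : ℝ)
            ((2 * l.1 + 2 + l.2 % 2 : ℕ) : ℝ) ∧ |F.eval x| = ((l.2 / 2 : ℕ) : ℝ) + 1) ∨
          (l.2 = 2 * k' ∧ x = ((2 * l.1 + 2 : ℕ) : ℝ))) ?_ ?_
    · rintro ⟨m, n⟩ hl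
      rw [Finset.mem_product, Finset.mem_range, Finset.mem_range] at hl
      obtain ⟨hm, hn⟩ := hl
      rcases Nat.lt_or_ge n (2 * k') with hn' | hn'
      · have hj : n / 2 < k' + 1 - 1 := by omega
        have hjk : ((n / 2 : ℕ) : ℝ) + 1 < ((k' + 1 : ℕ) : ℝ) := by
          have : n / 2 + 1 < k' + 1 := by omega
          exact_mod_cast this
        obtain ⟨x, hx, hFx⟩ : ∃ x ∈ Set.Ioo ((2 * m + 1 + n % 2 : ℕ) : ℝ)
            ((2 * m + 2 + n % 2 : ℕ) : ℝ), |F.eval x| = ((n / 2 : ℕ) : ℝ) + 1 := by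
          rcases Nat.mod_two_eq_zero_or_one n with h0 | h1
          · rw [h0, Nat.add_zero, Nat.add_zero]
            refine exists_Ioo_abs_eval_eq F (by exact_mod_cast (by omega : 2 * m + 1 < 2 * m + 2))
              (by positivity) (Or.inl ⟨witnessF_eval_even hF hm, ?_⟩)
            exact lt_of_lt_of_le hjk (witnessF_abs_eval_odd hF m)
          · rw [h1]
            refine exists_Ioo_abs_eval_eq F
              (by exact_mod_cast (by omega : 2 * m + 1 + 1 < 2 * m + 2 + 1)) (by positivity)
              (Or.inr ⟨?_, ?_⟩)
            · have h2 := witnessF_eval_even hF hm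
              rwa [show 2 * m + 1 + 1 = 2 * m + 2 from by ring]
            · have h3 := witnessF_abs_eval_odd hF (m + 1)
              rw [show 2 * (m + 1) + 1 = 2 * m + 2 + 1 from by ring] at h3
              exact lt_of_lt_of_le hjk h3
        refine ⟨x, (hmemZg x).mpr ?_, Or.inl ⟨hn', hx, hFx⟩⟩
        rw [hGdef]
        exact witnessG_eval_eq_zero_of_abs hQ hj hFx
      · have hn2 : n = 2 * k' := by omega
        refine ⟨((2 * m + 2 : ℕ) : ℝ), (hmemZg _).mpr ?_, Or.inr ⟨hn2, rfl⟩⟩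
        rw [hGdef]
        exact witnessG_eval_eq_zero_of_eval hQ (witnessF_eval_even hF hm)
    · intro x _
      rintro ⟨m, n⟩ hl ⟨m', n'⟩ hl'
      simp only [Set.mem_setOf_eq] at hl hl'
      obtain ⟨-, h⟩ := hl
      obtain ⟨-, h'⟩ := hl'
      simp only [Prod.mk.injEq]
      rcases h with ⟨hn, ⟨h1, h2⟩, h3⟩ | ⟨hn, hx⟩ <;>
        rcases h' with ⟨hn', ⟨h1', h2'⟩, h3'⟩ | ⟨hn', hx'⟩
      · have ha : 2 * m + 1 + n % 2 < 2 * m' + 2 + n' % 2 := by exact_mod_cast h1.trans h2'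
        have hb : 2 * m' + 1 + n' % 2 < 2 * m + 2 + n % 2 := by exact_mod_cast h1'.trans h2
        have hj : ((n / 2 : ℕ) : ℝ) = ((n' / 2 : ℕ) : ℝ) := by linarith [h3.symm.trans h3']
        have hj' : n / 2 = n' / 2 := by exact_mod_cast hj
        omega
      · exfalso
        rw [hx'] at h1 h2
        have ha : 2 * m + 1 + n % 2 < 2 * m' + 2 := by exact_mod_cast h1
        have hb : 2 * m' + 2 < 2 * m + 2 + n % 2 := by exact_mod_cast h2
        omega
      · exfalso
        rw [hx] at h1' h2'
        have ha : 2 * m' + 1 + n' % 2 < 2 * m + 2 := by exact_mod_cast h1'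
        have hb : 2 * m + 2 < 2 * m' + 2 + n' % 2 := by exact_mod_cast h2'
        omega
      · rw [hx] at hx'
        have : 2 * m + 2 = 2 * m' + 2 := by exact_mod_cast hx'
        omega
  -- assemble
  refine ⟨F, fun i => Q.coeff i, fun i => 2 * i + 1, Υ, Zg, Zf, fun i _ => Nat.succ_pos (2 * i),
    fun i hi => witnessQ_coeff_ne_zero hQ hi, ?_, ?_, ?_, hp_le, ?_⟩
  · ext x
    rw [Finset.mem_coe, hmemΥ, Set.mem_setOf_eq]
  · ext x
    rw [Finset.mem_coe, hmemZg, Set.mem_setOf_eq, hGeval]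
  · ext x
    rw [Finset.mem_coe, hmemZf, Set.mem_setOf_eq]
  · calc (1 + Υ.card) * (k' + 1 - 1) + Zf.card ≤ 2 * q * k' + q := by
          rw [Nat.add_sub_cancel]
          exact Nat.add_le_add (Nat.mul_le_mul_right _ hΥ_le) hZf_le
      _ = q * (2 * k' + 1) := by ring
      _ ≤ Zg.card := hZg_ge

/-- **KPT 2015, Theorem 25 in the `ℕ∞` vocabulary of `KPT2015_thm_8` / `KPT2015_thm_8_real`**
(p0013:L35–38): for every `k ≥ 1` and `p` there are a real polynomial `f`, non-zero coefficients
`a_i` and positive exponents `α_i` (`i < k`) such that the set `Υ` of real zeros of the prefix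
Wronskians `W((f^{α_i})_{i<s})`, `1 ≤ s ≤ k`, is finite with `p ≤ |Υ|`, and
`(1 + |Υ|)(k − 1) + Z_ℝ(f) ≤ Z_ℝ(Σ_{i<k} a_i f^{α_i})` — to be compared with Theorem 8's
`Z_ℝ(Σ a_i f_i) ≤ (1 + |Υ|)k − 1`. Immediate from `KPT2015_thm_25` (`realZeros g = |{g = 0}|` as
an extended natural). [cite: KoiranPortierTavenas2015, Theorem 25] -/
theorem KPT2015_thm_25_realZeros (k p : ℕ) (hk : 1 ≤ k) :
    ∃ (f : ℝ[X]) (a : ℕ → ℝ) (α : ℕ → ℕ),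
      (∀ i < k, 0 < α i) ∧ (∀ i < k, a i ≠ 0) ∧
      (p : ℕ∞) ≤ {x : ℝ | ∃ i, 1 ≤ i ∧ i ≤ k ∧
          wronskian (fun i y => f.eval y ^ α i) i x = 0}.encard ∧
      {x : ℝ | ∃ i, 1 ≤ i ∧ i ≤ k ∧ wronskian (fun i y => f.eval y ^ α i) i x = 0}.encard < ⊤ ∧
      (1 + {x : ℝ | ∃ i, 1 ≤ i ∧ i ≤ k ∧
          wronskian (fun i y => f.eval y ^ α i) i x = 0}.encard) * ((k - 1 : ℕ) : ℕ∞) +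
          realZeros (fun x => f.eval x) ≤
        realZeros (fun x => ∑ i ∈ Finset.range k, a i * f.eval x ^ α i) := by
  obtain ⟨f, a, α, Υ, Zg, Zf, hα, ha, hΥ, hZg, hZf, hp, hle⟩ := KPT2015_thm_25 k p hk
  refine ⟨f, a, α, hα, ha, ?_, ?_, ?_⟩
  · rw [← hΥ, Set.encard_coe_eq_coe_finsetCard]
    exact_mod_cast hp
  · rw [← hΥ, Set.encard_coe_eq_coe_finsetCard]
    exact WithTop.coe_lt_top _
  · unfold realZeros
    rw [← hΥ, ← hZg, ← hZf, Set.encard_coe_eq_coe_finsetCard, Set.encard_coe_eq_coe_finsetCard,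
      Set.encard_coe_eq_coe_finsetCard]
    exact_mod_cast hle

end Optimality

end Literature.Computability.AlgebraicComplexity.KoiranPortierTavenas2015
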